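/-
Copyright (c) 2026 the pub-hodgecm-mathlib formalisation cell (harness21).  Prover seat hodgecm-mathlib-F0P3a-p02 (g17): road «S3-ram» (junction pen F0P3a-p01 (g17),
J-PACK v2 (f) isoceles wave; lattice halves F0P3-p03 (g15)), residual half of ROW-AX-ROOT ∕ ROW-AX-INT ∕ ROW-AX-END in ADAPTED coordinates; 2026-09-02.
-/
import Literature.NumberTheory.Rogawski1990.DepthZeroKappaTransferTypeTwoRamifiedCollarCensus   -- ★ p847461 (this seat): the collar family `#{b : P(A + hCb²)}`, χ-counting generics
import HarnessLib

/-!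
# The residual census at an AXIS vertex in ADAPTED coordinates: isotropic vectors of `2αβ + νγ²` cut by the class of `Q = c·(νγ)² + λ·β²` — interior (`λ = 0`: two null
# lines, one class) and END (`λ ≠ 0`: the collar family `λ + cν²t²`) (Rogawski 1990 §4.9; Kottwitz 1986 §3)

Topic `NumberTheory/Rogawski1990`; namespace `Literature.NumberTheory.Rogawski1990`.  THEOREMS ONLY (no definition, no instance, no notation, no named fact, no `sorry`); kernel
lane `--supports stmt-HodgeConjecture-24833`; imports ★ `DepthZeroKappaTransferTypeTwoRamifiedCollarCensus` only (finite-field algebra).  Cell `pub/hodgecm-mathlib` (D-0151), crux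
H413; road «S3-ram» (count-neutral); junction J-PACK v2 (F0P3a-p01 (g17)) deal (f) ISOCELES wave, hand's proposal `ISO-ROWS-proposal.v1` (cfd30fc9): the RESIDUAL halves of
ROW-AX-ROOT ∕ ROW-AX-INT ∕ ROW-AX-END (lattice halves: F0P3-p03 (g15)).

THE DATUM (frame-free, bus 2026-09-02 01:26:41Z).  At an axis vertex of an isoceles type-(1) literal the residual leading matrix is `Ȳ = a(1 − π_u)` (interior ∕ root; `u` the
anisotropic eigenline of the isolated eigenvalue, `π_u` the orthogonal projection) or `Ȳ = a(1 − π_u) + λ·v v†` (END; `v` the inward ISOTROPIC line, `⟨u, v⟩ = 0`), so on an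
isotropic vector `x`: `Q(x) := ⟨x, Ȳx⟩ = c·⟨x,u⟩² + λ·⟨x,v⟩²`, `c = −a∕⟨u,u⟩`.  In a basis `(v, v′, u)` ADAPTED to the vertex (`v, v′` a hyperbolic pair of `u^⊥`, `⟨u,u⟩ = ν`)
with coordinates `x = αv + βv′ + γu`: `⟨x,x⟩ = 2αβ + νγ²`, `⟨x,u⟩ = νγ`, `⟨x,v⟩ = β`.  THIS FILE counts, for any predicate `P` invariant under non-zero squares,
  **`#{(α,β,γ) ≠ 0 : 2αβ + νγ² = 0 ∧ P(c(νγ)² + λβ²)} = (q−1)·([P 0] + #{t : P(λ + cν²·t²)})`**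
(fibres over `(⟨x,u⟩, ⟨x,v⟩)`: for `β ≠ 0` exactly one `α`, and the substitution `γ = βt`; for `β = 0` the inward line `γ = 0, α ≠ 0` with `Q = 0`) — §1; hence (§2) the INTERIOR
census (`λ = 0`, `c ≠ 0`): null vectors `2(q−1)` (the two axial lines `α`-axis and `β`-axis), every other isotropic vector in the ONE class of `c` (`(q−1)²` of them); and (§3)
the END census is the ★ collar family at `(g, A, h, C) = (1, λ, ν², c)`: null vectors `(q−1)(2 + χ(−λc))` (★ `card_collarNull_eq`: inward line + `1 + χ(−λc)` E-lines),
class counts `2·#_σ = (q−1)(q − 1 − χ(−λc) − σ·χ(c₀c))` (§3, one companion sum).  The frame change from the vertex's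
`J₀`-frame to the adapted basis is ★ `LinearAlgebra/QuadraticFormCountCongruence` (p847552); the anisotropic-plane case (BARE literals: no isotropic `v ⊥ u`) is §4: every non-zero
isotropic vector has `⟨x,u⟩ ≠ 0`, so all `q+1` lines carry the one class of `c`.
HONEST LABEL: HC_CM is proved only modulo the 2 remaining named inputs (hLiu418 24832, h413 24833) until rung 0 closes; finite-field algebra only, nothing printed is asserted.
-/

set_option autoImplicit false

namespace Literature.NumberTheory.Rogawski1990

open Finset

variable {k : Type*} [Field k] [Fintype k] [DecidableEq k]

/-! ## §1 The fibre count in adapted coordinates -/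

omit [DecidableEq k] in
/-- The substitution `γ = β·t` (`β ≠ 0`): `#{γ : P(c′γ² + λβ²)} = #{t : P(λ + c′t²)}` for a predicate `P` invariant under non-zero squares. [cite: IrelandRosen1990, Ch. 8 §1] -/
theorem card_filter_sq_add_eq_of_sqInvariant (P : k → Prop) [DecidablePred P] (hP : ∀ t z : k, z ≠ 0 → (P (z ^ 2 * t) ↔ P t))
    (c' l : k) {β : k} (hβ : β ≠ 0) :
    (univ.filter fun γ : k => P (c' * γ ^ 2 + l * β ^ 2)).card = (univ.filter fun t : k => P (l + c' * t ^ 2)).card := by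
  refine Finset.card_bij (fun γ _ => γ / β) (fun γ hγ => ?_) (fun γ₁ _ γ₂ _ h => ?_) (fun t ht => ⟨β * t, ?_, by field_simp⟩)
  · rw [Finset.mem_filter] at hγ ⊢
    refine ⟨Finset.mem_univ _, ?_⟩
    have key : c' * γ ^ 2 + l * β ^ 2 = β ^ 2 * (l + c' * (γ / β) ^ 2) := by field_simp; ring
    rw [key, hP _ _ hβ] at hγ
    exact hγ.2
  · exact (div_left_inj' hβ).1 h
  · rw [Finset.mem_filter] at ht ⊢
    refine ⟨Finset.mem_univ _, ?_⟩
    have key : c' * (β * t) ^ 2 + l * β ^ 2 = β ^ 2 * (l + c' * t ^ 2) := by ring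
    rw [key, hP _ _ hβ]
    exact ht.2

/-- **THE ADAPTED CENSUS.**  For `ν ≠ 0`, `char k ≠ 2`, any `c λ` and any predicate `P` invariant under non-zero squares:
`#{(α,β,γ) ≠ 0 : 2αβ + νγ² = 0 ∧ P(c(νγ)² + λβ²)} = (q−1)·([P 0] + #{t : P(λ + cν²t²)})` — the fibres of `(α,β,γ) ↦ (β, γ)`: for `β ≠ 0` one isotropic `α`, and `γ = βt`;
for `β = 0` the inward line `(α, 0, 0)`, `α ≠ 0`, where `Q = 0`. [cite: Rogawski1990, §4.9 Prop. 4.9.1 (b) p. 55] [cite: Kottwitz1986, §3] [cite: IrelandRosen1990, Ch. 8 §1] -/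
theorem card_iso_adapted_pred_eq (hk : ringChar k ≠ 2) {ν : k} (hν : ν ≠ 0) (c l : k) (P : k → Prop) [DecidablePred P]
    (hP : ∀ t z : k, z ≠ 0 → (P (z ^ 2 * t) ↔ P t)) :
    (univ.filter fun v : k × k × k => v ≠ 0 ∧ 2 * v.1 * v.2.1 + ν * v.2.2 ^ 2 = 0 ∧ P (c * (ν * v.2.2) ^ 2 + l * v.2.1 ^ 2)).card =
      (Fintype.card k - 1) * ((if P 0 then 1 else 0) + (univ.filter fun t : k => P (l + c * ν ^ 2 * t ^ 2)).card) := by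
  classical
  have h2 : (2 : k) ≠ 0 := Ring.two_ne_zero hk
  set S := univ.filter fun v : k × k × k => v ≠ 0 ∧ 2 * v.1 * v.2.1 + ν * v.2.2 ^ 2 = 0 ∧ P (c * (ν * v.2.2) ^ 2 + l * v.2.1 ^ 2) with hS
  rw [← Finset.card_filter_add_card_filter_not (s := S) (fun v => v.2.1 = 0)]
  -- PART A (`β = 0`): the inward line `(α, 0, 0)`, `α ≠ 0`, on which `Q = 0`
  have hA : (S.filter fun v => v.2.1 = 0).card = (Fintype.card k - 1) * (if P 0 then 1 else 0) := by
    by_cases hP0 : P 0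
    · rw [if_pos hP0, mul_one]
      have hset : (S.filter fun v => v.2.1 = 0) = (univ.filter fun α : k => α ≠ 0).image (fun α => (α, (0 : k), (0 : k))) := by
        ext v
        simp only [hS, Finset.mem_filter, Finset.mem_univ, true_and, Finset.mem_image, ne_eq]
        constructor
        · rintro ⟨⟨hv0, hiso, -⟩, hβ⟩
          rw [hβ, mul_zero, zero_add] at hiso
          have hγ : v.2.2 = 0 := pow_eq_zero_iff two_ne_zero |>.1 ((mul_eq_zero.1 hiso).resolve_left hν)
          refine ⟨v.1, fun hα => hv0 ?_, ?_⟩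
          · ext <;> simp [hα, hβ, hγ]
          · ext <;> simp [hβ, hγ]
        · rintro ⟨α, hα, rfl⟩
          refine ⟨⟨fun h => hα (congrArg Prod.fst h), by simp, by simpa using hP0⟩, rfl⟩
      rw [hset, Finset.card_image_of_injective _ (fun a b h => congrArg Prod.fst h), Finset.filter_ne' univ (0 : k),
        Finset.card_erase_of_mem (Finset.mem_univ _), Finset.card_univ]
    · rw [if_neg hP0, mul_zero, Finset.card_eq_zero, Finset.filter_eq_empty_iff]
      intro v hv hβ
      rw [hS, Finset.mem_filter] at hv
      obtain ⟨-, -, hiso, hPv⟩ := hv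
      rw [hβ, mul_zero, zero_add] at hiso
      have hγ : v.2.2 = 0 := pow_eq_zero_iff two_ne_zero |>.1 ((mul_eq_zero.1 hiso).resolve_left hν)
      rw [hβ, hγ] at hPv
      simp only [mul_zero, zero_pow two_ne_zero, add_zero] at hPv
      exact hP0 hPv
  -- PART B (`β ≠ 0`): project to `(β, γ)`; `α = −νγ²∕(2β)` is determined
  have hB : (S.filter fun v => ¬ v.2.1 = 0).card = (univ.filter fun w : k × k => w.1 ≠ 0 ∧ P (c * ν ^ 2 * w.2 ^ 2 + l * w.1 ^ 2)).card := by
    refine Finset.card_bij (fun v _ => (v.2.1, v.2.2)) (fun v hv => ?_) (fun v₁ hv₁ v₂ hv₂ h => ?_) (fun w hw => ?_)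
    · rw [Finset.mem_filter, hS, Finset.mem_filter] at hv
      obtain ⟨⟨-, -, -, hPv⟩, hβ⟩ := hv
      rw [Finset.mem_filter]
      exact ⟨Finset.mem_univ _, hβ, by rw [show c * ν ^ 2 * v.2.2 ^ 2 = c * (ν * v.2.2) ^ 2 by ring]; exact hPv⟩
    · rw [Finset.mem_filter, hS, Finset.mem_filter] at hv₁ hv₂
      obtain ⟨⟨-, -, hiso₁, -⟩, hβ₁⟩ := hv₁
      obtain ⟨⟨-, -, hiso₂, -⟩, -⟩ := hv₂
      have hβ : v₁.2.1 = v₂.2.1 := congrArg Prod.fst h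
      have hγ : v₁.2.2 = v₂.2.2 := congrArg Prod.snd h
      have hα : v₁.1 = v₂.1 := by
        have e₁ : v₁.1 = -(ν * v₁.2.2 ^ 2) / (2 * v₁.2.1) := by rw [eq_div_iff (mul_ne_zero h2 hβ₁)]; linear_combination hiso₁
        have e₂ : v₂.1 = -(ν * v₂.2.2 ^ 2) / (2 * v₂.2.1) := by
          rw [eq_div_iff (mul_ne_zero h2 (hβ ▸ hβ₁))]; linear_combination hiso₂
        rw [e₁, e₂, hβ, hγ]
      exact Prod.ext hα (Prod.ext hβ hγ)
    · rw [Finset.mem_filter] at hw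
      obtain ⟨-, hβ, hPw⟩ := hw
      refine ⟨(-(ν * w.2 ^ 2) / (2 * w.1), w.1, w.2), ?_, rfl⟩
      rw [Finset.mem_filter, hS, Finset.mem_filter]
      refine ⟨⟨Finset.mem_univ _, fun h => hβ (by simpa using congrArg (fun v : k × k × k => v.2.1) h), ?_, ?_⟩, hβ⟩
      · show 2 * (-(ν * w.2 ^ 2) / (2 * w.1)) * w.1 + ν * w.2 ^ 2 = 0
        field_simp; ring
      · show P (c * (ν * w.2) ^ 2 + l * w.1 ^ 2)
        rw [show c * (ν * w.2) ^ 2 = c * ν ^ 2 * w.2 ^ 2 by ring]; exact hPw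
  -- the projected count, fibrewise over `β ≠ 0`
  have hB' : (univ.filter fun w : k × k => w.1 ≠ 0 ∧ P (c * ν ^ 2 * w.2 ^ 2 + l * w.1 ^ 2)).card =
      (Fintype.card k - 1) * (univ.filter fun t : k => P (l + c * ν ^ 2 * t ^ 2)).card := by
    rw [Finset.card_filter, Fintype.sum_prod_type]
    have hrow : ∀ β : k, (∑ γ : k, if (β ≠ 0 ∧ P (c * ν ^ 2 * γ ^ 2 + l * β ^ 2)) then 1 else 0) =
        if β ≠ 0 then (univ.filter fun t : k => P (l + c * ν ^ 2 * t ^ 2)).card else 0 := by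
      intro β
      by_cases hβ : β = 0
      · simp [hβ]
      · rw [if_pos hβ, ← card_filter_sq_add_eq_of_sqInvariant P hP (c * ν ^ 2) l hβ, Finset.card_filter]
        exact Finset.sum_congr rfl (fun γ _ => by simp [hβ])
    rw [Finset.sum_congr rfl (fun β _ => hrow β), Finset.sum_ite, Finset.sum_const_zero, add_zero, Finset.sum_const, smul_eq_mul,
      Finset.filter_ne' univ (0 : k), Finset.card_erase_of_mem (Finset.mem_univ _), Finset.card_univ]
  rw [hA, hB, hB']
  ring

/-! ## §2 The INTERIOR axis vertex (`λ = 0`): two null lines, one class -/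

/-- `#{t : P(c·ν²·t²)} = [P 0] + (q−1)·[P c]` for `c, ν ≠ 0` and square-invariant `P`. [cite: IrelandRosen1990, Ch. 8 §1] -/
theorem card_filter_pred_mul_sq_eq {ν c : k} (hν : ν ≠ 0) (P : k → Prop) [DecidablePred P] (hP : ∀ t z : k, z ≠ 0 → (P (z ^ 2 * t) ↔ P t)) :
    (univ.filter fun t : k => P (0 + c * ν ^ 2 * t ^ 2)).card = (if P 0 then 1 else 0) + (Fintype.card k - 1) * (if P c then 1 else 0) := by
  have hsplit := (Finset.card_filter_add_card_filter_not (s := univ.filter fun t : k => P (0 + c * ν ^ 2 * t ^ 2)) (fun t => t = 0)).symm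
  rw [Finset.filter_filter, Finset.filter_filter] at hsplit
  rw [hsplit]
  congr 1
  · by_cases hP0 : P 0
    · rw [if_pos hP0, Finset.card_eq_one]
      exact ⟨0, by ext t; simp only [Finset.mem_filter, Finset.mem_univ, true_and, Finset.mem_singleton]; exact ⟨fun h => h.2, fun h => ⟨by rw [h]; simpa using hP0, h⟩⟩⟩
    · rw [if_neg hP0, Finset.card_eq_zero, Finset.filter_eq_empty_iff]
      rintro t - ⟨ht, ht0⟩
      rw [ht0] at ht
      simp only [zero_pow two_ne_zero, mul_zero, add_zero] at ht
      exact hP0 ht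
  · have hiff : ∀ t : k, ¬ t = 0 → (P (0 + c * ν ^ 2 * t ^ 2) ↔ P c) := fun t ht => by
      rw [zero_add, show c * ν ^ 2 * t ^ 2 = (ν * t) ^ 2 * c by ring]
      exact hP c (ν * t) (mul_ne_zero hν ht)
    by_cases hPc : P c
    · rw [if_pos hPc, mul_one]
      have hset : (univ.filter fun t : k => P (0 + c * ν ^ 2 * t ^ 2) ∧ ¬ t = 0) = univ.erase 0 := by
        ext t
        simp only [Finset.mem_filter, Finset.mem_univ, true_and, Finset.mem_erase, and_true]
        exact ⟨fun h => h.2, fun h => ⟨(hiff t h).2 hPc, h⟩⟩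
      rw [hset, Finset.card_erase_of_mem (Finset.mem_univ _), Finset.card_univ]
    · rw [if_neg hPc, mul_zero, Finset.card_eq_zero, Finset.filter_eq_empty_iff]
      rintro t - ⟨ht, ht0⟩
      exact hPc ((hiff t ht0).1 ht)

/-- **THE INTERIOR CENSUS**: `#{(α,β,γ) ≠ 0 : 2αβ + νγ² = 0 ∧ P(c(νγ)²)} = (q−1)·(2·[P 0] + (q−1)·[P c])` (`ν, c ≠ 0`, `P` square-invariant) — two null LINES (the axial
directions `α`- and `β`-axis) and the ONE class of `c` on the other `q − 1` lines. [cite: Rogawski1990, §4.9 Prop. 4.9.1 (b) p. 55] [cite: Kottwitz1986, §3] -/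
theorem card_iso_adapted_interior_eq (hk : ringChar k ≠ 2) {ν c : k} (hν : ν ≠ 0) (P : k → Prop) [DecidablePred P]
    (hP : ∀ t z : k, z ≠ 0 → (P (z ^ 2 * t) ↔ P t)) :
    (univ.filter fun v : k × k × k => v ≠ 0 ∧ 2 * v.1 * v.2.1 + ν * v.2.2 ^ 2 = 0 ∧ P (c * (ν * v.2.2) ^ 2 + 0 * v.2.1 ^ 2)).card =
      (Fintype.card k - 1) * (2 * (if P 0 then 1 else 0) + (Fintype.card k - 1) * (if P c then 1 else 0)) := by
  rw [card_iso_adapted_pred_eq hk hν c 0 P hP, card_filter_pred_mul_sq_eq hν P hP]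
  ring

/-- Interior, NULL count: `2(q−1)` null isotropic vectors (`c ≠ 0`). [cite: Rogawski1990, §4.9 Prop. 4.9.1 (b) p. 55] -/
theorem card_iso_adapted_interior_null (hk : ringChar k ≠ 2) {ν c : k} (hν : ν ≠ 0) (hc : c ≠ 0) :
    (univ.filter fun v : k × k × k => v ≠ 0 ∧ 2 * v.1 * v.2.1 + ν * v.2.2 ^ 2 = 0 ∧ c * (ν * v.2.2) ^ 2 + 0 * v.2.1 ^ 2 = 0).card = (Fintype.card k - 1) * 2 := by
  rw [card_iso_adapted_interior_eq hk hν (fun t => t = 0) (fun t z hz => by simp [hz])]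
  simp [hc]

/-- Interior, CLASS count: `(q−1)²·[χ(c₀c) = σ]` isotropic vectors with `χ(c₀·Q) = σ` (`σ = ±1`, `ν ≠ 0`; for `c₀c = 0` both sides vanish). [cite: Rogawski1990, §4.9 Prop. 4.9.1 (b) p. 55] [cite: IrelandRosen1990, Ch. 8 §1] -/
theorem card_iso_adapted_interior_class (hk : ringChar k ≠ 2) {ν c c₀ : k} (hν : ν ≠ 0) {σ : ℤ} (hσ : σ = 1 ∨ σ = -1) :
    (univ.filter fun v : k × k × k => v ≠ 0 ∧ 2 * v.1 * v.2.1 + ν * v.2.2 ^ 2 = 0 ∧ quadraticChar k (c₀ * (c * (ν * v.2.2) ^ 2 + 0 * v.2.1 ^ 2)) = σ).card =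
      (Fintype.card k - 1) * ((Fintype.card k - 1) * (if quadraticChar k (c₀ * c) = σ then 1 else 0)) := by
  have hP : ∀ t z : k, z ≠ 0 → (quadraticChar k (c₀ * (z ^ 2 * t)) = σ ↔ quadraticChar k (c₀ * t) = σ) := fun t z hz => by
    rw [show c₀ * (z ^ 2 * t) = c₀ * t * z ^ 2 by ring, map_mul, map_pow, quadraticChar_sq_one hz, mul_one]
  rw [card_iso_adapted_interior_eq hk hν (fun t => quadraticChar k (c₀ * t) = σ) hP]
  have h0 : ¬ (quadraticChar k (c₀ * 0) = σ) := by
    rw [mul_zero, MulChar.map_zero]; rcases hσ with rfl | rfl <;> decide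
  rw [if_neg h0, mul_zero, zero_add]

/-! ## §3 The END axis vertex (`λ ≠ 0`): the collar family `λ + cν²t²` -/

/-- `Σ_t χ(c₀(λ + c′t²)) = −χ(c₀c′)` for `λ, c′, c₀ ≠ 0` (companion sum). [cite: IrelandRosen1990, Ch. 8 §2] [cite: LidlNiederreiter1996, Theorem 5.50] -/
theorem sum_quadraticChar_mul_add_mul_sq (hk : ringChar k ≠ 2) {l c' c₀ : k} (hl : l ≠ 0) (hc' : c' ≠ 0) (hc₀ : c₀ ≠ 0) :
    ∑ t : k, quadraticChar k (c₀ * (l + c' * t ^ 2)) = -quadraticChar k (c₀ * c') := by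
  have hrw : ∀ t : k, c₀ * (l + c' * t ^ 2) = c₀ * c' * (t ^ 2 + l / c') := fun t => by field_simp; ring
  simp_rw [hrw, map_mul (quadraticChar k) (c₀ * c')]
  rw [← Finset.mul_sum]
  have hI : ∑ t : k, quadraticChar k (t ^ 2 + l / c') = -1 :=
    Literature.FieldTheory.FiniteFields.JacobsthalSums.companionSum_two hk (div_ne_zero hl hc')
  rw [hI, mul_neg, mul_one]

/-- **THE END CENSUS, NULL count**: `(q−1)·(2 + χ(−λ·c))` null isotropic vectors (`λ, c, ν ≠ 0`) — the inward line plus `1 + χ(−λc)` E-lines (BIG literal `3`, SMALL `1`).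
[cite: Rogawski1990, §4.9 Prop. 4.9.1 (b) p. 55] [cite: Kottwitz1986, §3] -/
theorem card_iso_adapted_end_null (hk : ringChar k ≠ 2) {ν c l : k} (hν : ν ≠ 0) (hc : c ≠ 0) (hl : l ≠ 0) :
    ((univ.filter fun v : k × k × k => v ≠ 0 ∧ 2 * v.1 * v.2.1 + ν * v.2.2 ^ 2 = 0 ∧ c * (ν * v.2.2) ^ 2 + l * v.2.1 ^ 2 = 0).card : ℤ) =
      ((Fintype.card k : ℤ) - 1) * (2 + quadraticChar k (-(l * c))) := by
  rw [card_iso_adapted_pred_eq hk hν c l (fun t => t = 0) (fun t z hz => by simp [hz])]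
  simp only [if_true]
  -- `#{t : λ + cν²t² = 0}` = `#{t ≠ 0 : 1·(λ + ν²·c·t²) = 0}` = `1 + χ(−λν²c)` (★ collar census), and `χ(ν²) = 1`
  have hset : (univ.filter fun t : k => l + c * ν ^ 2 * t ^ 2 = 0) = (univ.filter fun t : k => t ≠ 0 ∧ (1 : k) * (l + ν ^ 2 * c * t ^ 2) = 0) := by
    ext t
    simp only [Finset.mem_filter, Finset.mem_univ, true_and, one_mul]
    constructor
    · intro h
      refine ⟨?_, by linear_combination h⟩
      rintro rfl
      apply hl
      simpa using h
    · rintro ⟨-, h⟩; linear_combination h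
  have hcol := card_collarNull_eq hk (one_ne_zero) (pow_ne_zero 2 hν) hl hc (g := (1 : k)) (h := ν ^ 2) (A := l) (C := c)
  rw [hset]
  push_cast
  rw [Nat.cast_sub Fintype.card_pos, Nat.cast_one, hcol, show -(l * ν ^ 2 * c) = -(l * c) * ν ^ 2 by ring, map_mul, map_pow, quadraticChar_sq_one hν, mul_one]
  ring

/-- **THE END CENSUS, CLASS count**: `2·#{iso ≠ 0 : χ(c₀Q) = σ} = (q−1)·(q − 1 − χ(−λc) − σ·χ(c₀c))` (`λ, c, c₀, ν ≠ 0`, `σ = ±1`) — in LINE currency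
`2·N_σ = q − 1 − χ(−λc) − σχ(c₀c)`: BIG literal (`χ(−λc) = 1`) `((q−3)∕2, (q−1)∕2)`, SMALL `((q−1)∕2, (q+1)∕2)` (B-p14 CENSUS-G6-axis §0).
[cite: Rogawski1990, §4.9 Prop. 4.9.1 (b) p. 55] [cite: IrelandRosen1990, Ch. 8 §2] -/
theorem two_mul_card_iso_adapted_end_class (hk : ringChar k ≠ 2) {ν c l c₀ : k} (hν : ν ≠ 0) (hc : c ≠ 0) (hl : l ≠ 0) (hc₀ : c₀ ≠ 0) {σ : ℤ} (hσ : σ = 1 ∨ σ = -1) :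
    2 * ((univ.filter fun v : k × k × k => v ≠ 0 ∧ 2 * v.1 * v.2.1 + ν * v.2.2 ^ 2 = 0 ∧ quadraticChar k (c₀ * (c * (ν * v.2.2) ^ 2 + l * v.2.1 ^ 2)) = σ).card : ℤ) =
      ((Fintype.card k : ℤ) - 1) * ((Fintype.card k : ℤ) - 1 - quadraticChar k (-(l * c)) - σ * quadraticChar k (c₀ * c)) := by
  have hP : ∀ t z : k, z ≠ 0 → (quadraticChar k (c₀ * (z ^ 2 * t)) = σ ↔ quadraticChar k (c₀ * t) = σ) := fun t z hz => by
    rw [show c₀ * (z ^ 2 * t) = c₀ * t * z ^ 2 by ring, map_mul, map_pow, quadraticChar_sq_one hz, mul_one]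
  rw [card_iso_adapted_pred_eq hk hν c l (fun t => quadraticChar k (c₀ * t) = σ) hP]
  have h0 : ¬ (quadraticChar k (c₀ * 0) = σ) := by
    rw [mul_zero, MulChar.map_zero]; rcases hσ with rfl | rfl <;> decide
  rw [if_neg h0, zero_add]
  -- `2·#{t : χ(c₀(λ + c′t²)) = σ} = q − #{t : λ + c′t² = 0} + σ·Σ_t χ(c₀(λ + c′t²))` with `c′ = cν²`
  have hc' : c * ν ^ 2 ≠ 0 := mul_ne_zero hc (pow_ne_zero 2 hν)
  have hcnt := two_mul_card_filter_quadraticChar_eq (k := k) (fun _ : k => True) (fun t => c₀ * (l + c * ν ^ 2 * t ^ 2)) hσ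
  have hsum : (∑ t : k, if True then quadraticChar k (c₀ * (l + c * ν ^ 2 * t ^ 2)) else 0) = -quadraticChar k (c₀ * c) := by
    simp only [if_true]
    rw [sum_quadraticChar_mul_add_mul_sq hk hl hc' hc₀, show c₀ * (c * ν ^ 2) = c₀ * c * ν ^ 2 by ring, map_mul, map_pow, quadraticChar_sq_one hν, mul_one]
  have hnull : ((univ.filter fun t : k => True ∧ c₀ * (l + c * ν ^ 2 * t ^ 2) = 0).card : ℤ) = 1 + quadraticChar k (-(l * c)) := by
    have hset : (univ.filter fun t : k => True ∧ c₀ * (l + c * ν ^ 2 * t ^ 2) = 0) = (univ.filter fun t : k => t ≠ 0 ∧ (1 : k) * (l + ν ^ 2 * c * t ^ 2) = 0) := by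
      ext t
      simp only [Finset.mem_filter, Finset.mem_univ, true_and, one_mul, mul_eq_zero, hc₀, false_or]
      constructor
      · intro h
        refine ⟨?_, by linear_combination h⟩
        rintro rfl; apply hl; simpa using h
      · rintro ⟨-, h⟩; linear_combination h
    rw [hset, card_collarNull_eq hk one_ne_zero (pow_ne_zero 2 hν) hl hc, show -(l * ν ^ 2 * c) = -(l * c) * ν ^ 2 by ring, map_mul, map_pow,
      quadraticChar_sq_one hν, mul_one]
  have htrue : ((univ.filter fun _ : k => True).card : ℤ) = Fintype.card k := by simp
  have hfilt : (univ.filter fun t : k => True ∧ quadraticChar k (c₀ * (l + c * ν ^ 2 * t ^ 2)) = σ) = (univ.filter fun t : k => quadraticChar k (c₀ * (l + c * ν ^ 2 * t ^ 2)) = σ) := by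
    simp only [true_and]
  rw [hfilt] at hcnt
  rw [hsum, hnull, htrue] at hcnt
  push_cast
  rw [Nat.cast_sub Fintype.card_pos, Nat.cast_one]
  linear_combination ((Fintype.card k : ℤ) - 1) * hcnt

end Literature.NumberTheory.Rogawski1990
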